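import Summits.BirchSwinnertonDyer.BirchSwinnertonDyer.Theorems.GenusKolyvaginAtTwoGenusPrimitiveSupplyAtTwoPrimeTwistEggBitFiniteSha
import HarnessLib

/-!
# Route `GenusKolyvaginAtTwo`, crux #2 `GenusPrimitiveSupplyAtTwo` (stmt-BirchSwinnertonDyer-22136):
# an ODD Cassels–Tate form CAPS THE RANK of an admissible twist at `1` — unconditionally (no finiteness, no rank hypothesis)

Width seat `bsd-line-gk2-p5` g16 (cell `bsd-f1-sign2`, SUPPLY lineage of crux 22136), file 46 of the series; sequel of files 42–44. THEOREMS
ONLY (no definition, no named fact, no `sorry`); helper `--supports stmt-BirchSwinnertonDyer-22136`; no item is closed; BSD is not proved by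
any of this.

WHAT.
* §199 **`mordellWeilRank_le_one_of_not_shaTwoInTwiceShaFour_of_model`** — `W` on the odd branch, `d` descent-admissible with character `χ`,
  ANY model `V = C • W^{(d)}` with `θ(V) = −` ⟹ `rank V(ℚ) ≤ 1`, and `rank V(ℚ) = 1 ↔ #Ш(V)[2] = 4` (`rank 0 ↔ #Ш(V)[2] = 8`).  Proof: the
  descent count `8 = 2^{rank}·#V(ℚ)[2]·#Ш(V)[2]` with `#V(ℚ)[2] = 1`; `θ = −` exhibits a non-zero class so `#Ш(V)[2] ≥ 2`, hence
  `rank ≤ 2`; `rank = 2` would give `#Ш(V)[2] = 2`, excluded by the full kernel lemma (file 43 §190: `#Ш[2] ≤ 4 ∧ θ = − ⟹ #Ш[2] = 4`).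
  So on the odd branch the `θ = −` admissible twists are EXACTLY the candidates of rank `1`; the alternative `rank 0 ∧ Ш(V)[2] ≅ (ℤ/2)³`
  (infinite `Ш[2^∞] ⊇ ℚ₂/ℤ₂`) is what finiteness of `Ш` (file 44) or `L'(V,1) ≠ 0` removes.

Honest framing: Cassels 1962 §1 bookkeeping on the cell's frame; kernel-new; beyond-print theorem: no. Crux 22136 stays OPEN exactly at (U) 24947 ∧
(CONV₂) 19220/24948. BSD is not proved by any of this.

References: [Cassels1962ArithmeticIV] §1; [Kramer1981] Prop. 6; [SilvermanAEC2009] Thm. X.4.2(a).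
-/

set_option linter.dupNamespace false -- tree convention: `Summit.BirchSwinnertonDyer.BirchSwinnertonDyer.Theorems` (summit = sub-problem)
set_option autoImplicit false

noncomputable section

open scoped Classical

namespace Summit.BirchSwinnertonDyer.BirchSwinnertonDyer.Theorems.GenusKolyArch

open WeierstrassCurve Field NumberField IsDedekindDomain
open Literature.NumberTheory.EllipticCurves Literature.NumberTheory.GaloisRepresentations
open Summit.BirchSwinnertonDyer.Rank1Residual.F1Sign2
open Summit.BirchSwinnertonDyer.Rank1Residual.F1Sign2.EggDoubling (eq_zero_of_two_smul_eq_zero)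
open Literature.NumberTheory.EllipticCurves.Greenberg1999 (HasRationalTwoTorsionX)

/-! ## §199 `θ = −` caps the rank at `1` -/

section Frame

variable (W : WeierstrassCurve ℚ) [W.IsGloballyMinimal] {d : ℤ}
  {χ : absoluteGaloisGroup ℚ →ₜ* Multiplicative (ZMod 2)}

/-- **§199 — an ODD Cassels–Tate form caps the rank of an admissible twist at `1`** (no finiteness, no rank hypothesis): for `W` on the odd
branch, `d` descent-admissible with character `χ`, and ANY model `V = C • W^{(d)}` with `θ(V) = −`: `rank V(ℚ) ≤ 1`, and
`rank V(ℚ) = 1 ↔ #Ш(V)[2] = 4`. See the module docstring. [cite: Cassels1962ArithmeticIV, §1] [cite: Kramer1981, Prop. 6]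
[cite: SilvermanAEC2009, Thm X.4.2(a)] -/
theorem mordellWeilRank_le_one_of_not_shaTwoInTwiceShaFour_of_model (hodd : OnOddBranchAtTwo W) (hd : DescAdmissible W d)
    (hχ : IsQuadraticCharacterOf χ d) {V : WeierstrassCurve ℚ} [V.IsElliptic] {C : VariableChange ℚ}
    (hWd : C • W.quadraticTwist (d : ℚ) = V) (hθ : ¬ ShaTwoInTwiceShaFour V) :
    V.mordellWeilRank ≤ 1 ∧ (V.mordellWeilRank = 1 ↔ Nat.card ↥(V.sha ⊓ AddSubgroup.torsionBy V.galH1 ((2 : ℕ) : ℤ)) = 4) := by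
  have hd0 : d ≠ 0 := hd.1.ne
  have hd0' : ((d : ℤ) : ℚ) ≠ 0 := Int.cast_ne_zero.mpr hd0
  -- no rational `2`-torsion on the model `V`
  have hTV : NoRationalTwoTorsion V := by
    intro x hx
    have h' : HasRationalTwoTorsionX (W.quadraticTwist (d : ℚ)) (C⁻¹.toX x) := by
      have h := PrimeConductorTwoTorsion.hasRationalTwoTorsionX_smul V C⁻¹ hx
      rwa [← hWd, inv_smul_smul] at h
    obtain ⟨x', hx'⟩ := (exists_hasRationalTwoTorsionX_quadraticTwist_iff W hd0').mp ⟨_, h'⟩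
    exact hodd.2.1 x' hx'
  -- the descent count `8 = 2^rank · #V(ℚ)[2] · #Ш(V)[2]`, `#V(ℚ)[2] = 1`
  have hSel8 : Nat.card (V.selmerGroup ((2 : ℕ) : ℤ)) = 8 := by
    rw [← natCard_primeTwist_selmerGroup_eq_natCard_selmerGroup_rat W hd0 hχ hWd,
      natCard_primeTwist_selmerGroup_eq_twistSelmerTwoCard W hd0 hχ]
    exact hodd.2.2.2.2 d hd
  have hcount := card_selmerGroup_eq_pow_rank_mul V 2
  rw [hSel8] at hcount
  have hinst : (instDecidableEqRat : DecidableEq ℚ) = fun a b => Classical.propDecidable (a = b) := Subsingleton.elim _ _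
  have ha : Nat.card (AddSubgroup.torsionBy V.toAffine.Point ((2 : ℕ) : ℤ)) = 1 := by
    have hbot : AddSubgroup.torsionBy V.toAffine.Point ((2 : ℕ) : ℤ) = ⊥ :=
      (AddSubgroup.eq_bot_iff_forall _).mpr fun P hP ↦
        eq_zero_of_two_smul_eq_zero V hTV P (AddSubgroup.torsionBy.nsmul_iff.mp hP)
    rw [hbot, AddSubgroup.card_bot]
  rw [hinst] at ha
  rw [ha, mul_one] at hcount
  -- `#Ш(V)[2] ≥ 2` (`θ = −` exhibits a non-zero class)
  have hb0 : Nat.card ↥(V.sha ⊓ AddSubgroup.torsionBy V.galH1 ((2 : ℕ) : ℤ)) ≠ 0 := fun h0 ↦ by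
    rw [h0, mul_zero] at hcount; exact absurd hcount (by norm_num)
  haveI : Finite ↥(V.sha ⊓ AddSubgroup.torsionBy V.galH1 ((2 : ℕ) : ℤ)) := Nat.finite_of_card_ne_zero hb0
  have hb2 : 2 ≤ Nat.card ↥(V.sha ⊓ AddSubgroup.torsionBy V.galH1 ((2 : ℕ) : ℤ)) := by
    have hθ' := hθ
    unfold ShaTwoInTwiceShaFour at hθ'
    push Not at hθ'
    obtain ⟨s, hs, hs2, hsnot⟩ := hθ'
    have hs0 : s ≠ 0 := fun h ↦ hsnot 0 V.sha.zero_mem (nsmul_zero _) (by rw [nsmul_zero, h])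
    set H : AddSubgroup V.galH1 := V.sha ⊓ AddSubgroup.torsionBy V.galH1 ((2 : ℕ) : ℤ) with hH
    have hsub : ({0, s} : Set V.galH1) ⊆ (H : Set V.galH1) := by
      intro y hy
      simp only [Set.mem_insert_iff, Set.mem_singleton_iff] at hy
      rcases hy with rfl | rfl
      · exact H.zero_mem
      · exact AddSubgroup.mem_inf.mpr ⟨hs, AddSubgroup.torsionBy.nsmul_iff.mpr hs2⟩
    have hle := Set.ncard_le_ncard hsub (Set.toFinite _)
    rw [Set.ncard_pair hs0.symm, (Nat.card_coe_set_eq (H : Set V.galH1)).symm] at hle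
    exact hle
  -- the full kernel lemma: `#Ш(V)[2] ≤ 4 ⟹ #Ш(V)[2] = 4`
  have hfour : Nat.card ↥(V.sha ⊓ AddSubgroup.torsionBy V.galH1 ((2 : ℕ) : ℤ)) ≤ 4 →
      Nat.card ↥(V.sha ⊓ AddSubgroup.torsionBy V.galH1 ((2 : ℕ) : ℤ)) = 4 :=
    fun hle ↦ (natCard_sha_two_eq_four_and_exponent_two_of_natCard_le_four V hle hb0 hθ).1
  -- arithmetic: `8 = 2^r · b`, `2 ≤ b`, `b ≤ 4 → b = 4`
  have key : ∀ r b : ℕ, 8 = 2 ^ r * b → 2 ≤ b → (b ≤ 4 → b = 4) → r ≤ 1 ∧ (r = 1 ↔ b = 4) := by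
    intro r b h hb h4
    have hr2 : r ≤ 2 := by
      by_contra hgt
      push Not at hgt
      have h8 : 8 ≤ 2 ^ r := by
        calc (8 : ℕ) = 2 ^ 3 := rfl
          _ ≤ 2 ^ r := Nat.pow_le_pow_right two_pos hgt
      have : 8 * 2 ≤ 2 ^ r * b := Nat.mul_le_mul h8 hb
      omega
    interval_cases r
    · refine ⟨by omega, ⟨fun h0 ↦ absurd h0 (by omega), fun hb4 ↦ ?_⟩⟩
      rw [hb4] at h; omega
    · refine ⟨le_rfl, ⟨fun _ ↦ by omega, fun _ ↦ rfl⟩⟩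
    · exfalso
      have hb2' : b = 2 := by omega
      have := h4 (by omega)
      omega
  exact key _ _ hcount hb2 hfour

/-- **Corollary: on the frame, `θ(V) = −` and `rank V(ℚ) ≠ 0` already give `rank V(ℚ) = 1`** (so B⁰'s clause «`θ = − ⟹ 0 < rank`» is
equivalent to «`θ = − ⟹ rank = 1`» and to «`θ = − ⟹ #Ш(V)[2] = 4`»). [cite: Cassels1962ArithmeticIV, §1] [cite: Kramer1981, Prop. 6] -/
theorem mordellWeilRank_eq_one_iff_natCard_sha_two_eq_four_of_model (hodd : OnOddBranchAtTwo W) (hd : DescAdmissible W d)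
    (hχ : IsQuadraticCharacterOf χ d) {V : WeierstrassCurve ℚ} [V.IsElliptic] {C : VariableChange ℚ}
    (hWd : C • W.quadraticTwist (d : ℚ) = V) (hθ : ¬ ShaTwoInTwiceShaFour V) :
    (0 < V.mordellWeilRank ↔ V.mordellWeilRank = 1) ∧
      (V.mordellWeilRank = 1 ↔ Nat.card ↥(V.sha ⊓ AddSubgroup.torsionBy V.galH1 ((2 : ℕ) : ℤ)) = 4) := by
  obtain ⟨hle, hiff⟩ := mordellWeilRank_le_one_of_not_shaTwoInTwiceShaFour_of_model W hodd hd hχ hWd hθ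
  exact ⟨⟨fun h ↦ by omega, fun h ↦ by omega⟩, hiff⟩

end Frame

end Summit.BirchSwinnertonDyer.BirchSwinnertonDyer.Theorems.GenusKolyArch

end
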